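/-
Copyright: the b2b-balaban T⁴-continuum CRUX team, row NE7b OWNER lineage `t4-ne7b-p1` (gen 141). Project licence.
-/
import Summits.QuantumFields.BalabanUV.T4Continuum.Spine.NE7b.SupWeightedCovarianceDecay
import Summits.QuantumFields.BalabanUV.T4Continuum.Spine.NE7b.SupWhitenedFirstOrderLetters

/-!
# THE NEUMANN MATRIX OF THE WHITENED DOBRUSHIN MATRIX IS ADMISSIBLE, WITH ITS WEIGHTED LETTERS (SCOPING (d13)(1), ninth file).  The class-map
# files (477)–(479), (483), (484) take an ADMISSIBLE `D` (`D ≥ 0`, `δ_{xy} + Σ_zD_{xz}C_{zy} ≤ D_{xy}` for `C_{xw} = HA_{xw}∕(1−lamA)` off the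
# diagonal) carrying the weighted letters `Σ_wD_{zw}θ_{zw} ≤ dθ`, `Σ_zD_{zw}θ_{zw} ≤ dθ′` as HYPOTHESES.  This file discharges them BY NAME for
# the Neumann series `D = Σ_nC^n` ((448)∕(453)∕(462), as inside (468)'s proof): under `Hk ≥ 0`, `lamA < 1`, a submultiplicative sampler weight
# `θ ≥ 1` with `θ_{xx} = 1` and the weighted smallness `Σ_wC_{xw}θ_{xw} ≤ γθ < 1` (rows), `Σ_xC_{xw}θ_{xw} ≤ γθ′ < 1` (columns),
#   `D ≥ 0`,  `δ + D·C ≤ D`,  `Σ_wD_{zw}θ_{zw} ≤ (1−γθ)⁻¹`,  `Σ_zD_{zw}θ_{zw} ≤ (1−γθ′)⁻¹`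
# — so `dθ = (1−γθ)⁻¹`, `dθ′ = (1−γθ′)⁻¹`, and with (476) (`γθ, γθ′` = plain letters × range factor for a finite-range factor) EVERY hypothesis
# of the kernel-letter class map at orders 2–3 is a class letter, a geometry letter or a smallness (row NE7b, node U5c; (448) `neumann_nonneg`,
# `neumann_dominates`, (453) `neumann_weighted_rowsum_le`, `rowsum_le_weighted`, (462) `neumann_weighted_colsum_le`, (456) `whitened_cross_nonneg`
# BY NAME; [folklore])

Cell `pub-balaban`, sub-cell `t4`, spine estimate NE7b (`T4WeightBudget.RelWeightBound`; the cell's OWN estimate — NOT PRINTED in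
[Bałaban 1983–89], NOT PROVED).  Crux-route work under `Spine/NE7b/` by the row OWNER (`t4-ne7b-p1` gen 141, file (485)) under FREEZE
(0)'s crux-prover clause; NOTHING of Bałaban's is named as a Lean object, valued or asserted; no `T4Continuum/Support` leaf typed; no
`def`, no notation (`C` and `D` WRITTEN OUT); zero `sorry`.  Imports (BY NAME): the OWNER's (462) `…SupWeightedCovarianceDecay`
(`neumann_weighted_colsum_le`; through it (453), (448)), (456) `…SupWhitenedFirstOrderLetters` (`whitened_cross_nonneg`).

WHAT IS PROVED ([folklore]): `whitenedC_nonneg`, **`neumannD_nonneg`**, **`neumannD_dominates`**, **`neumannD_weighted_rowsum`**,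
**`neumannD_weighted_colsum`**; toy.

HONEST (what this is NOT).  Packaging of (448)∕(453)∕(462) for the whitened matrix; the smallness `γθ, γθ′ < 1` is the hypothesis ((476)
reduces it to plain letters × `e^{8μ(2R+R′)}`); scalar skeleton ((A3), NC-NE7b-α UNRULED); nothing of Bałaban's asserted.  BY-NAME EFFECT ON
THE WALL: NONE.  NE7b NOT PRINTED ∕ NOT PROVED; spine PROVED 0∕9; rung (B)+1 — the programme's measures remain FINITE-torus statements; NOT
the mass gap, NOT Clay.  HONEST DEPENDENCY: continuum YM on T⁴ ⇐ BetaPertH ∧ nine spine estimates (0∕9 proved); BetaPertH ⇐ (D1) ∧ (D4) ∧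
CAP+tail; G-an2-4 gates asym, D1 and NE2∕3∕4.
-/

set_option autoImplicit false

noncomputable section

namespace Summit.QuantumFields.BalabanUV.T4Continuum.NE7b.SupWhitenedNeumannAdmissible

open Real Finset Matrix
open scoped BigOperators
open SupDobrushinNeumannMatrix (neumann_nonneg neumann_dominates)
open SupDobrushinWeightedNeumann (neumann_weighted_rowsum_le rowsum_le_weighted)
open SupWeightedCovarianceDecay (neumann_weighted_colsum_le)
open SupWhitenedFirstOrderLetters (whitened_cross_nonneg)

variable {ι κ : Type} [Fintype ι] [Fintype κ] [DecidableEq κ]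

variable {Hk : ι → ι → ℝ} {A : Matrix ι κ ℝ} {lamA γθ γθ' : ℝ} {θ : κ → κ → ℝ}

omit [Fintype κ] in
/-- **The whitened Dobrushin matrix is entrywise nonnegative** (`Hk ≥ 0`, `lamA < 1`). [folklore] -/
theorem whitenedC_nonneg (hHk0 : ∀ v u, 0 ≤ Hk v u) (hlamA1 : lamA < 1) (x w : κ) :
    0 ≤ (Matrix.of fun x w : κ => (if w = x then 0 else ∑ u, ∑ v, |A u w| * |A v x| * Hk v u) / (1 - lamA)) x w := by
  rw [Matrix.of_apply]
  refine div_nonneg ?_ (by linarith)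
  split_ifs
  · exact le_rfl
  · exact whitened_cross_nonneg hHk0 A x w

/-- **`D = Σ_nC^n ≥ 0`**. [folklore] -/
theorem neumannD_nonneg (hHk0 : ∀ v u, 0 ≤ Hk v u) (hlamA1 : lamA < 1) (x y : κ) :
    0 ≤ ∑' n : ℕ, ((Matrix.of fun x w : κ => (if w = x then 0 else ∑ u, ∑ v, |A u w| * |A v x| * Hk v u) / (1 - lamA)) ^ n) x y :=
  neumann_nonneg (whitenedC_nonneg hHk0 hlamA1) x y

/-- **Admissibility `δ_{xy} + Σ_zD_{xz}C_{zy} ≤ D_{xy}`** (the resolvent identity of (448), under the weighted row smallness `γθ < 1` against a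
weight `θ ≥ 1`). [folklore] -/
theorem neumannD_dominates [Nonempty κ] (hHk0 : ∀ v u, 0 ≤ Hk v u) (hlamA1 : lamA < 1) (hθw1 : ∀ x z, 1 ≤ θ x z)
    (hCθ : ∀ x : κ, ∑ w, (if w = x then 0 else ∑ u, ∑ v, |A u w| * |A v x| * Hk v u) / (1 - lamA) * θ x w ≤ γθ) (hγθ1 : γθ < 1) (x y : κ) :
    (if x = y then (1 : ℝ) else 0) +
        ∑ z, (∑' n : ℕ, ((Matrix.of fun x w : κ => (if w = x then 0 else ∑ u, ∑ v, |A u w| * |A v x| * Hk v u) / (1 - lamA)) ^ n) x z) *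
          ((if y = z then 0 else ∑ u, ∑ v, |A u y| * |A v z| * Hk v u) / (1 - lamA)) ≤
      ∑' n : ℕ, ((Matrix.of fun x w : κ => (if w = x then 0 else ∑ u, ∑ v, |A u w| * |A v x| * Hk v u) / (1 - lamA)) ^ n) x y := by
  obtain ⟨w₀⟩ := ‹Nonempty κ›
  set Cm : Matrix κ κ ℝ := Matrix.of fun x w : κ => (if w = x then 0 else ∑ u, ∑ v, |A u w| * |A v x| * Hk v u) / (1 - lamA) with hCm
  have hCmnn : ∀ x w, 0 ≤ Cm x w := whitenedC_nonneg hHk0 hlamA1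
  have hCθ' : ∀ x, ∑ w, Cm x w * θ x w ≤ γθ := fun x => by simp only [hCm, Matrix.of_apply]; exact hCθ x
  have hθnn : ∀ x z, 0 ≤ θ x z := fun x z => zero_le_one.trans (hθw1 x z)
  have hγθ0 : 0 ≤ γθ := le_trans (Finset.sum_nonneg fun w _ => mul_nonneg (hCmnn w₀ w) (hθnn w₀ w)) (hCθ' w₀)
  have hCmrow : ∀ x, ∑ w, Cm x w ≤ γθ := rowsum_le_weighted hCmnn hθw1 hCθ'
  have h := neumann_dominates hCmnn hCmrow hγθ0 hγθ1 x y
  simp only [hCm, Matrix.of_apply] at h ⊢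
  exact h

/-- **The weighted row letter `Σ_wD_{zw}θ_{zw} ≤ (1−γθ)⁻¹`**. [folklore] -/
theorem neumannD_weighted_rowsum [Nonempty κ] (hHk0 : ∀ v u, 0 ≤ Hk v u) (hlamA1 : lamA < 1) (hθw1 : ∀ x z, 1 ≤ θ x z) (hθdiag : ∀ x, θ x x = 1)
    (hθmul : ∀ x y z, θ x z ≤ θ x y * θ y z)
    (hCθ : ∀ x : κ, ∑ w, (if w = x then 0 else ∑ u, ∑ v, |A u w| * |A v x| * Hk v u) / (1 - lamA) * θ x w ≤ γθ) (hγθ1 : γθ < 1) (z : κ) :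
    ∑ w, (∑' n : ℕ, ((Matrix.of fun x w : κ => (if w = x then 0 else ∑ u, ∑ v, |A u w| * |A v x| * Hk v u) / (1 - lamA)) ^ n) z w) * θ z w ≤
      (1 - γθ)⁻¹ := by
  obtain ⟨w₀⟩ := ‹Nonempty κ›
  set Cm : Matrix κ κ ℝ := Matrix.of fun x w : κ => (if w = x then 0 else ∑ u, ∑ v, |A u w| * |A v x| * Hk v u) / (1 - lamA) with hCm
  have hCmnn : ∀ x w, 0 ≤ Cm x w := whitenedC_nonneg hHk0 hlamA1
  have hCθ' : ∀ x, ∑ w, Cm x w * θ x w ≤ γθ := fun x => by simp only [hCm, Matrix.of_apply]; exact hCθ x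
  have hθnn : ∀ x z, 0 ≤ θ x z := fun x z => zero_le_one.trans (hθw1 x z)
  have hγθ0 : 0 ≤ γθ := le_trans (Finset.sum_nonneg fun w _ => mul_nonneg (hCmnn w₀ w) (hθnn w₀ w)) (hCθ' w₀)
  exact neumann_weighted_rowsum_le hCmnn hθw1 hθdiag hθmul hCθ' hγθ0 hγθ1 z

/-- **The weighted column letter `Σ_zD_{zw}θ_{zw} ≤ (1−γθ′)⁻¹`**. [folklore] -/
theorem neumannD_weighted_colsum [Nonempty κ] (hHk0 : ∀ v u, 0 ≤ Hk v u) (hlamA1 : lamA < 1) (hθw1 : ∀ x z, 1 ≤ θ x z) (hθdiag : ∀ x, θ x x = 1)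
    (hθmul : ∀ x y z, θ x z ≤ θ x y * θ y z)
    (hCθc : ∀ w : κ, ∑ x, (if w = x then 0 else ∑ u, ∑ v, |A u w| * |A v x| * Hk v u) / (1 - lamA) * θ x w ≤ γθ') (hγθ'1 : γθ' < 1) (w : κ) :
    ∑ z, (∑' n : ℕ, ((Matrix.of fun x w : κ => (if w = x then 0 else ∑ u, ∑ v, |A u w| * |A v x| * Hk v u) / (1 - lamA)) ^ n) z w) * θ z w ≤
      (1 - γθ')⁻¹ := by
  obtain ⟨w₀⟩ := ‹Nonempty κ›
  set Cm : Matrix κ κ ℝ := Matrix.of fun x w : κ => (if w = x then 0 else ∑ u, ∑ v, |A u w| * |A v x| * Hk v u) / (1 - lamA) with hCm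
  have hCmnn : ∀ x w, 0 ≤ Cm x w := whitenedC_nonneg hHk0 hlamA1
  have hCθc' : ∀ w, ∑ x, Cm x w * θ x w ≤ γθ' := fun w => by simp only [hCm, Matrix.of_apply]; exact hCθc w
  have hθnn : ∀ x z, 0 ≤ θ x z := fun x z => zero_le_one.trans (hθw1 x z)
  have hγθ'0 : 0 ≤ γθ' := le_trans (Finset.sum_nonneg fun z _ => mul_nonneg (hCmnn z w₀) (hθnn z w₀)) (hCθc' w₀)
  exact neumann_weighted_colsum_le hCmnn hθw1 hθdiag hθmul hCθc' hγθ'0 hγθ'1 w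

/-! ## Toy -/

/-- Toy (the letters in numbers): `γθ = 1∕2` gives `dθ = (1 − 1∕2)⁻¹ = 2`. -/
example : (1 - (1 : ℝ) / 2)⁻¹ = 2 := by norm_num

end Summit.QuantumFields.BalabanUV.T4Continuum.NE7b.SupWhitenedNeumannAdmissible

end
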